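/-
Origin: expansion seat `literature-prover-pub-hodgecm-landherr-g4-0`, handover 2026-08-18 (`HOME/pub-hodgecm-landherr-g4/handover/HodgeCM/Literature/NormTheoremHolds.lean`, md5 940853dd, 238 lines);
landed by the gen-6 packager in gate run 22 as `HodgeCM/Literature/NormTheoremHolds.lean` (verbatim).
-/
-- pub-hodgecm EXPANSION part (c) Landherr, gen 4 (session planner-pub-hodgecm-landherr-g4-0, unit pub-hodgecm-landherr-g4), 2026-08-18.
-- Proposed final place: HodgeCM/Literature/NormTheoremHolds.lean (imports the vendored cone HodgeCM/Vendored/H21/** + gen 3's HodgeCM/Literature/NormTheorem.lean).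
import Literature.NumberTheory.Automorphic.QuaternionAlgebraEmbeddingHolds
import Literature.NumberTheory.Automorphic.QuaternionAlgebraAdelicRamificationProofs
import Literature.NumberTheory.Automorphic.QuaternionRamificationParity
import Literature.NumberTheory.QuadraticForms.HilbertSymbolLocalQuinary
import Literature.NumberTheory.QuadraticForms.GlobalSquareTheorem
import Literature.NumberTheory.GaloisRepresentations.HeckeCharacterWeakApproximation
import Summits.HodgeConjecture.HodgeCM.Literature.NormTheorem_2

/-!
# The norm theorem for quaternion algebras over number fields — proved

`HodgeCM.Literature.Vigneras_III_4_1_holds : Vigneras_III_4_1` discharges the last cited input of the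
Landherr part (c) (`HodgeCM.Literature.Vigneras_III_4_1`, CITED-FACTS NT-1; Vignéras, LNM 800, Ch. III
Thm. 4.1 = Hasse–Schilling–Maass–Eichler: `n(H) = K_H`), and with it
`HodgeCM.lemma33bLandherr_holds : HodgeCM.Lemma33bLandherr` (Lemma 3.3(b), [La36]) becomes an
unconditional theorem of the package, via gen 3's `lemma33bLandherr_of_normTheorem`.

## Proof (Vignéras Ch. III, proof of Thm. 4.1 from Thm. 3.8)

Let `H = ℍ[K,a,b]`, `x ∈ Kˣ` positive at the real places ramified in `H`.  Let `S` = the finite places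
ramified in `H` together with one more finite place `v₀`.  For `v ∈ S` pick `c_v ∈ K_v` with
`c_v² - x ∉ K_v²` (a binary form over a local field represents at least two square classes:
`exists_binary_eq_not_isSquare_mul`).  By weak approximation (`denseRange_algebraMap_pi_prod`) choose
`k ∈ K` so close to `c_v` at `v ∈ S` that `k² - x ∉ K_v²` (local square theorem,
`isSquare_div_of_valued_sub_lt`), and so small at the real places that `σ_w(k)² < |σ_w(x)|`.  Then
`e := k² - x` is: not a square in `K` (look at `v₀`); not a square in `K_v` for `v ∈ Ram_f(H)`; negative,
hence not a square, at every `w ∈ Ram_∞(H)` (there `σ_w(x) > 0` by hypothesis, `Ram_∞(H)` being the real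
places with `σ_w(a), σ_w(b) < 0`: `ramifiedInfinitePlaces_eq_setOf_neg`).  By the embedding theorem
(Vignéras III Thm. 3.8 (1), `exists_sq_eq_of_not_isSquare_ramified_holds` — proved in the vendored tree from
Hasse's norm theorem for quadratic extensions and the local norm indices) some `y ∈ H` has `y² = e`;
as `e ∉ K²`, `y` is a pure quaternion, `e = a y₁² + b y₂² - a b y₃²`, and
`n(k + y₁ i + y₂ j + y₃ ij) = k² - a y₁² - b y₂² + a b y₃² = k² - e = x`.

Inputs: only theorems (the vendored harness-tree development `HodgeCM.Vendored.H21.*`, kernel-checked,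
`#print axioms` = the standard trio) and Mathlib.  No named fact, no hypothesis.
-/

noncomputable section

open NumberField IsDedekindDomain Topology Quaternion
open Literature.NumberTheory.Automorphic Literature.NumberTheory.QuadraticForms
  Literature.NumberTheory.GaloisRepresentations

namespace HodgeCM
namespace Literature

open _root_.Literature.AlgebraicGeometry.ShimuraVarieties (conjRingHomK)

/-! ### Two elementary lemmas -/

section Local

variable (K : Type) [Field K] [NumberField K] (v : HeightOneSpectrum (𝓞 K))

/-- In a local field `K_v` (`v` finite), for `x ≠ 0` some `c` has `c² - x ∉ K_v²`: the binary form
`⟨1, -x⟩` represents a non-square `t = y² - x z²` (`exists_binary_eq_not_isSquare_mul`, Serre IV §2.2),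
necessarily with `z ≠ 0`; take `c = y / z`. -/
theorem exists_sq_sub_not_isSquare {x : v.adicCompletion K} (hx : x ≠ 0) :
    ∃ c : v.adicCompletion K, ¬ IsSquare (c ^ 2 - x) := by
  obtain ⟨t, -, ⟨y, z, hyz⟩, hts⟩ :=
    exists_binary_eq_not_isSquare_mul K v (a := 1) (b := -x) (x₀ := 1)
      one_ne_zero (neg_ne_zero.2 hx) one_ne_zero
  rw [mul_one] at hts
  have hz : z ≠ 0 := by
    rintro rfl
    exact hts ⟨y, by linear_combination -hyz⟩
  refine ⟨y / z, fun ⟨r, hr⟩ ↦ hts ⟨r * z, ?_⟩⟩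
  have key : t = ((y / z) ^ 2 - x) * z ^ 2 := by
    field_simp
    linear_combination -hyz
  rw [key, hr]
  ring

end Local

/-- If the square of a quaternion `y ∈ ℍ[K,a,b]` is a scalar `e ∉ K²`, then `y` is pure and
`e = a y₁² + b y₂² - a b y₃²`. -/
theorem eq_of_mul_self_eq_algebraMap {K : Type*} [Field K] [CharZero K] {a b e : K} (y : ℍ[K,a,b])
    (hy : y * y = algebraMap K _ e) (he : ¬ IsSquare e) :
    e = a * y.imI ^ 2 + b * y.imJ ^ 2 - a * b * y.imK ^ 2 := by
  rw [QuaternionAlgebra.algebraMap_eq] at hy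
  obtain ⟨h0, h1, h2, h3⟩ := QuaternionAlgebra.ext_iff.mp hy
  simp only [QuaternionAlgebra.re_mul, QuaternionAlgebra.imI_mul, QuaternionAlgebra.imJ_mul,
    QuaternionAlgebra.imK_mul, zero_mul, add_zero] at h0 h1 h2 h3
  by_cases hre : y.re = 0
  · rw [hre] at h0
    linear_combination -h0
  · exfalso
    have h1' : y.imI = 0 := by
      have : (2 * y.re) * y.imI = 0 := by linear_combination h1
      exact (mul_eq_zero.mp this).resolve_left (mul_ne_zero two_ne_zero hre)
    have h2' : y.imJ = 0 := by
      have : (2 * y.re) * y.imJ = 0 := by linear_combination h2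
      exact (mul_eq_zero.mp this).resolve_left (mul_ne_zero two_ne_zero hre)
    have h3' : y.imK = 0 := by
      have : (2 * y.re) * y.imK = 0 := by linear_combination h3
      exact (mul_eq_zero.mp this).resolve_left (mul_ne_zero two_ne_zero hre)
    rw [h1', h2', h3'] at h0
    exact he ⟨y.re, by linear_combination -h0⟩

/-! ### The norm theorem -/

/-- **Vignéras III Thm. 4.1 (Hasse–Schilling–Maass–Eichler norm theorem), proved**: over a number field
`K`, every `x ∈ Kˣ` positive at the real places ramified in `{a,b}` is a reduced norm
`h₀² - a h₁² - b h₂² + a b h₃²` of `ℍ[K,a,b]`.  See the module docstring for the proof. -/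
theorem Vigneras_III_4_1_holds : Vigneras_III_4_1 := by
  intro K _ _ a b ha hb x hx hpos
  classical
  haveI : NeZero (2 : K) := ⟨two_ne_zero⟩
  haveI hQ : IsQuaternionAlgebra K ℍ[K,a,b] := QuaternionAlgebra.isQuaternionAlgebra_holds ha hb
  have hfin : (ramifiedPlaces K ℍ[K,a,b]).Finite := ramifiedPlaces_finite_holds K ℍ[K,a,b]
  obtain ⟨v₀⟩ := nonempty_heightOneSpectrum (K := K)
  set S : Finset (HeightOneSpectrum (𝓞 K)) := insert v₀ hfin.toFinset with hS_def
  have hxv : ∀ v : HeightOneSpectrum (𝓞 K), algebraMap K (v.adicCompletion K) x ≠ 0 :=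
    fun v ↦ (map_ne_zero _).2 hx
  -- local data at `S`
  choose c hc using fun v : (S : Type) ↦ exists_sq_sub_not_isSquare K v.1 (hxv v.1)
  let f : ∀ v : (S : Type), v.1.adicCompletion K → v.1.adicCompletion K :=
    fun v y ↦ y ^ 2 - algebraMap K _ x
  have he0 : ∀ v, f v (c v) ≠ 0 := fun v h ↦ hc v (by rw [show c v ^ 2 - _ = f v (c v) from rfl, h]; exact IsSquare.zero)
  -- the neighbourhoods: finite part
  let U : ∀ v : (S : Type), Set (v.1.adicCompletion K) :=
    fun v ↦ {y | Valued.v (f v y - f v (c v)) < Valued.v (4 * f v (c v)) ∧ f v y ≠ 0}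
  have hU : ∀ v, U v ∈ 𝓝 (c v) := by
    intro v
    haveI : CharZero (v.1.adicCompletion K) :=
      charZero_of_injective_algebraMap (algebraMap K _).injective
    have hcont : Continuous (f v) := (continuous_id.pow 2).sub continuous_const
    have h4 : (4 : v.1.adicCompletion K) ≠ 0 := by norm_num
    have hne : Valued.v.restrict (4 * f v (c v)) ≠ 0 := by simp [h4, he0 v]
    have hball : {z : v.1.adicCompletion K | Valued.v (z - f v (c v)) < Valued.v (4 * f v (c v))} ∈
        𝓝 (f v (c v)) := by
      rw [Valued.mem_nhds]
      refine ⟨Units.mk0 _ hne, fun y hy ↦ ?_⟩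
      rw [Set.mem_setOf_eq, Units.val_mk0] at hy
      exact Valued.v.restrict_lt_iff.mp hy
    have hne' : {z : v.1.adicCompletion K | z ≠ 0} ∈ 𝓝 (f v (c v)) := isOpen_ne.mem_nhds (he0 v)
    exact hcont.continuousAt.preimage_mem_nhds (Filter.inter_mem hball hne')
  -- infinite part
  let V : ∀ w : InfinitePlace K, Set w.Completion := fun w ↦
    if hw : w.IsReal then
      {y | (InfinitePlace.Completion.ringEquivRealOfIsReal hw y) ^ 2 <
        |InfinitePlace.embedding_of_isReal hw x|}
    else Set.univ
  have hV : ∀ w : InfinitePlace K, V w ∈ 𝓝 (0 : w.Completion) := by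
    intro w
    by_cases hw : w.IsReal
    · simp only [V, dif_pos hw]
      have hcont0 : Continuous (InfinitePlace.Completion.ringEquivRealOfIsReal hw) :=
        (InfinitePlace.Completion.isometryEquivRealOfIsReal hw).continuous
      have hcont : Continuous fun y : w.Completion ↦
          (InfinitePlace.Completion.ringEquivRealOfIsReal hw y) ^ 2 := hcont0.pow 2
      refine (isOpen_lt hcont continuous_const).mem_nhds ?_
      show (InfinitePlace.Completion.ringEquivRealOfIsReal hw 0) ^ 2 < |InfinitePlace.embedding_of_isReal hw x|
      rw [map_zero, zero_pow two_ne_zero]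
      exact abs_pos.2 ((map_ne_zero _).2 hx)
    · simp only [V, dif_neg hw]
      exact Filter.univ_mem
  have hUpi : Set.pi Set.univ U ∈ 𝓝 (fun v : (S : Type) ↦ c v) :=
    set_pi_mem_nhds Set.finite_univ fun v _ ↦ hU v
  have hVpi : Set.pi Set.univ V ∈ 𝓝 (fun w : InfinitePlace K ↦ (0 : w.Completion)) :=
    set_pi_mem_nhds Set.finite_univ fun w _ ↦ hV w
  have hprod : (Set.pi Set.univ U) ×ˢ (Set.pi Set.univ V) ∈
      𝓝 ((fun v : (S : Type) ↦ c v), (fun w : InfinitePlace K ↦ (0 : w.Completion))) :=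
    prod_mem_nhds hUpi hVpi
  -- weak approximation
  obtain ⟨_, ⟨⟨k, rfl⟩, hkU, hkV⟩⟩ := (denseRange_algebraMap_pi_prod (K := K) S).inter_nhds_nonempty hprod
  simp only [Set.mem_pi, Set.mem_univ, forall_const] at hkU hkV
  -- the element `e = k² - x`
  set E : K := k ^ 2 - x with hE
  have hfk : ∀ v : (S : Type), f v (algebraMap K _ k) = algebraMap K _ E := by
    intro v
    simp only [f, hE, map_sub, map_pow]
  have hEv : ∀ v : (S : Type), ¬ IsSquare (algebraMap K (v.1.adicCompletion K) E) := by
    intro v hsq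
    obtain ⟨h1, h2⟩ : algebraMap K _ k ∈ U v := hkU v
    rw [hfk] at h1 h2
    have hdiv := (isSquare_div_of_valued_sub_lt K v.1 (he0 v) h1).2
    apply hc v
    have : f v (c v) = (f v (c v) / algebraMap K _ E) * algebraMap K _ E := by
      rw [div_mul_cancel₀ _ h2]
    rw [show c v ^ 2 - algebraMap K _ x = f v (c v) from rfl, this]
    exact hdiv.mul hsq
  have hE_nsq : ¬ IsSquare E := fun h ↦
    hEv ⟨v₀, by simp [hS_def]⟩ (h.map (algebraMap K (v₀.adicCompletion K)))
  have hEfin : ∀ v ∈ ramifiedPlaces K ℍ[K,a,b], ¬ IsSquare (algebraMap K (v.adicCompletion K) E) :=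
    fun v hv ↦ hEv ⟨v, by simp [hS_def, hfin.mem_toFinset, hv]⟩
  have hEinf : ∀ w ∈ ramifiedInfinitePlaces K ℍ[K,a,b], ¬ IsSquare (algebraMap K w.Completion E) := by
    intro w hw
    rw [ramifiedInfinitePlaces_eq_setOf_neg K ℍ[K,a,b] ha hb AlgEquiv.refl] at hw
    obtain ⟨hwr, hwa, hwb⟩ := hw
    have hxpos : 0 < InfinitePlace.embedding_of_isReal hwr x :=
      hpos _ ((ramifiedAtReal_iff a b _).2 ⟨hwa, hwb⟩)
    have hk : algebraMap K _ k ∈ V w := hkV w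
    simp only [V, dif_pos hwr, Set.mem_setOf_eq, ringEquivRealOfIsReal_algebraMap] at hk
    rw [abs_of_pos hxpos] at hk
    apply not_isSquare_completion_of_embedding_neg K hwr
    rw [hE, map_sub, map_pow]
    linarith
  -- the embedding theorem (Vignéras III Thm. 3.8 (1))
  obtain ⟨y, hy⟩ := exists_sq_eq_of_not_isSquare_ramified_holds K ℍ[K,a,b] E hE_nsq hEfin hEinf
  have hcoord := eq_of_mul_self_eq_algebraMap y hy hE_nsq
  refine ⟨![k, y.imI, y.imJ, y.imK], ?_⟩
  simp only [quatNorm, Matrix.cons_val_zero, Matrix.cons_val_one, Matrix.cons_val]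
  linear_combination hcoord

/-! ### Landherr's Lemma 3.3(b), unconditionally -/

/-- **Lemma 3.3(b) [La36] holds**: `HodgeCM.Lemma33bLandherr` (the typed target of
`HodgeCM/StubTree/Inputs.lean`) is a theorem — gen 3's reduction `lemma33bLandherr_of_normTheorem`
fed with `Vigneras_III_4_1_holds`. -/
theorem lemma33bLandherr_holds : Lemma33bLandherr :=
  lemma33bLandherr_of_normTheorem Vigneras_III_4_1_holds

/-- The **rank-2 Landherr classification** as an unconditional `iff` (gen 3's
`landherr_rank2_iff_of_normTheorem` with the norm theorem proved; the converse direction is gen 1's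
`lemma33bLandherr_converse`). -/
theorem landherr_rank2_iff (L : CMField) (a : Fin 4 → L) (ha : ∀ i, conjRingHomK L (a i) = a i)
    (ha0 : ∀ i, a i ≠ 0) :
    (∃ g : GL (Fin 2) L,
      ((g : Matrix (Fin 2) (Fin 2) L).transpose.map (conjRingHomK L)) * Matrix.diagonal ![a 0, a 1] *
        (g : Matrix (Fin 2) (Fin 2) L) = Matrix.diagonal ![a 2, a 3]) ↔
    ((∀ τ : L →+* ℂ,
      ({decide (0 < (τ (a 0)).re), decide (0 < (τ (a 1)).re)} : Multiset Bool) =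
        {decide (0 < (τ (a 2)).re), decide (0 < (τ (a 3)).re)}) ∧
    ∃ z : L, z ≠ 0 ∧ a 0 * a 1 = a 2 * a 3 * (z * conjRingHomK L z)) :=
  landherr_rank2_iff_of_normTheorem Vigneras_III_4_1_holds L a ha ha0

end Literature

/-- Root-namespace alias: `HodgeCM.lemma33bLandherr_holds : HodgeCM.Lemma33bLandherr`. -/
theorem lemma33bLandherr_holds : Lemma33bLandherr := Literature.lemma33bLandherr_holds

end HodgeCM

end
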